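import Literature.Barriers.AtomisticToContinuum.HardDiskLemma5Proofs
import Literature.Barriers.AtomisticToContinuum.HardDiskTranslationInvarianceFinalSteps
import HarnessLib

/-!
# Richthammer's Theorem 1 for hard discs reduces to the finite-volume inequality (5.8)

Status file of the provefact programme for
`Literature.Barriers.AtomisticToContinuum.HardDisk.Richthammer2007_hardDisk`
(`HardDiskTranslationInvariance.lean`; Richthammer 2007, §2 Theorem 1 for the Euclidean hard
disc). The printed proof "Theorem 1 ⇐ Lemma 5 + (3.5)" is the tree's
`Richthammer2007_hardDisk_of_lemma5_of_ineq35` (`HardDiskTranslationInvarianceSteps.lean`); of its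
two named inputs,

* Lemma 5 is discharged: `Richthammer2007_lemma5_holds` (`HardDiskLemma5Proofs.lean`, via tail
  conditioning, Friedli–Velenik Prop. 6.61, in place of the extremal decomposition of §4.3);
* (3.5) is reduced to the finite-volume form of (5.8) with Lemma 13:
  `Richthammer2007_ineq35_of_ineq58` (`HardDiskTranslationInvarianceFinalSteps.lean`).

Hence the whole theorem now rests on the single named fact `Richthammer2007_ineq58` (the
hard-core preserving generalised translation `𝔗_n` of §5.2–5.4 with Lemmas 8–13; its
probabilistic inputs Lemma 3 (`Richthammer2007_lemma3_holds`), Lemma 7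
(`Richthammer2007_lemma7`, `HardDiskClusterBound.lean`) and the §6.8 expectation estimates
(`tendsto_lintegral_sigma₁/₂/₃`, `HardDiskPathSums.lean`) are proved in the tree). This file
records that reduction as a theorem, so that a proof `h : Richthammer2007_ineq58` closes
Theorem 1 in one line: `Richthammer2007_hardDisk_of_ineq58 h`.

## References

* [Richthammer2007] T. Richthammer, *Translation-invariance of two-dimensional Gibbsian point
  processes*, Comm. Math. Phys. 274 (2007) 81–122, arXiv:0706.3637: §2 Theorem 1 (p. 4), §3.5
  Lemma 5 (p. 8), §5.5 (5.8) and the final steps (p. 12).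
-/

namespace Literature.Barriers.AtomisticToContinuum.HardDisk

/-- **Theorem 1 for hard discs from the finite-volume inequality (5.8) alone.** Given
`Richthammer2007_ineq58` (the §5.5 computation with Lemmas 9–13 packaged), every Gibbs measure
of the planar hard-disc model at every activity `z > 0` is invariant under all translations:
(5.8) ⇒ (3.5) (`Richthammer2007_ineq35_of_ineq58`, §5.5 last paragraph), Lemma 5 holds
(`Richthammer2007_lemma5_holds`), and Theorem 1 ⇐ Lemma 5 + (3.5)
(`Richthammer2007_hardDisk_of_lemma5_of_ineq35`, "Now the claim of the theorem follows from
Lemma 5"). [cite: Richthammer2007, §5.5 (p. 12) and §2 Theorem 1 (p. 4)] -/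
theorem Richthammer2007_hardDisk_of_ineq58 (h : Richthammer2007_ineq58) : Richthammer2007_hardDisk :=
  Richthammer2007_hardDisk_of_lemma5_of_ineq35 Richthammer2007_lemma5_holds
    (Richthammer2007_ineq35_of_ineq58 h)

end Literature.Barriers.AtomisticToContinuum.HardDisk
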